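import Summits.BirchSwinnertonDyer.BirchSwinnertonDyer.Theorems.EisensteinPrimesMazurMCOnX1RankZeroCongruenceRoadMuPart
import HarnessLib

/-!
# Crux `MazurMCOnX1RankZero` (stmt-BirchSwinnertonDyer-19035), line `mudescent`, stub
# `stub_analyticMuZero_offLocus`: the registered stub DECOMPOSED ALONG THE CONGRUENCE ROAD —
# `stub ⟺ (S′) ∧ (M′)` — and the road's CIRCULARITY (cell `bsd-eis`, seat `bsd-eis-mu-c` g2,
# PROGRAMME PART 1b seat (3); NEGATIVE-expected probe — closes NO stub; route-INDEPENDENT imports)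

Sequel of `EisensteinPrimesMazurMCOnX1RankZeroCongruenceRoadMuPart.lean` (§0–§3 there: an
`E[p]`-congruent ordinary partner `V` with the certificate `μ_an(V) = 0` buys exactly Greenberg's
`μ(X(W₀/ℚ_∞)) = 0`, so that, given such a partner, `AnalyticMuLE W₀ p 0 ↔ MuPartAt W₀ p`).

WHAT THIS FILE PROVES (theorems only; no `def`, no named fact, no `sorry`):
* §4 `stub_of_partnerSupply_of_muPart`, `partnerSupply_of_stub`, **`stub_iff_partnerSupply_and_muPart`**:
  the registered signature of the stub (verbatim, left side) ⟺ (S′) «every rank-`0` X1 curve off the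
  barrier locus has a GOOD-ORDINARY `E[p]`-congruent partner with `μ_an = 0`» ∧ (M′) «`MuPartAt W₀ p`
  (the μ-part of Mazur's main conjecture, `μ_an ≤ μ_alg`) at every such curve» — granted Wuthrich
  Thm. 16, modularity, GV p. 26 / (7) / Prop. (2.5). The stub supplies its own partner (`V = W₀`,
  `E[p] ≅ E[p]`), so (S′) is a weakening of the stub; against mu-b's decomposition
  `stub ⟺ (M′) ∧ (G′)` (p462224; (G′) = Greenberg's `μ = 0` at every étale end) the congruence road
  RELAXES (G′) to (S′) and leaves (M′) untouched. `stub_of_partnerSupply'_of_muPart`: the same with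
  MULTIPLICATIVE partners allowed (a multiplicative `E[p]`-partner of a `ClassX1` curve is a split
  X2b curve — predecessor file p460893 — so this is the crux-5 ↔ row-A10 bridge of the road).
* §5 `muPart_offLocus_of_mazurMainConjecture`, `transfer_of_mazurMainConjecture`: (M′) follows from
  the crux itself (stated through its conclusion predicate `Rank1ResidualX1Defs.MazurMainConjecture`,
  without importing the route file), hence under the crux g0's transfer (T) holds at every leaf
  target: the road is CONSISTENT and CIRCULAR — its one unprinted step is the crux's own μ-part.

HONEST FRAMING: a PROBE; nothing here proves or refutes the stub; hypotheses are PUBLISHED named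
facts only (`hW16`, `hWu`, `hmod`, `hGV`, `hA`, `hB`, `hT`, `hT'`, `hAm`, `hBm`, `hF`), as in the
tree's route-G files. References: [GreenbergVatsal2000] Thm. (1.4), p. 4, pp. 26–27;
[GreenbergLNM1716] Conj. 1.11, p. 132; [Wuthrich2014] Thm. 16; HOME
`run/shared/lean/pub/bsd-eis/mu-c-MEMO-1.md` ADDENDUM 3.
-/

set_option autoImplicit false

-- `Summit.BirchSwinnertonDyer.BirchSwinnertonDyer.…`: the summit and its single sub-problem share a name (D-0017 layout).
set_option linter.dupNamespace false

noncomputable section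

open scoped Classical MatrixGroups ModularForm

open CongruenceSubgroup WeierstrassCurve NumberField IsDedekindDomain
  Literature.NumberTheory.EllipticCurves Literature.NumberTheory.EllipticCurves.ModularForms
  Literature.NumberTheory.EllipticCurves.Rank1Residual
  Literature.NumberTheory.EllipticCurves.GreenbergVatsal2000
  Literature.Barriers.BirchSwinnertonDyer
  Summit.BirchSwinnertonDyer.Rank1Residual
  Summit.BirchSwinnertonDyer.Rank1Residual.X1.CongruenceTransfer
  Summit.BirchSwinnertonDyer.Rank1Residual.X1.MuLambda
  Summit.BirchSwinnertonDyer.Rank1Residual.X1.MuPart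
  Summit.BirchSwinnertonDyer.Rank1Residual.X1.MuStructure
  Summit.BirchSwinnertonDyer.BirchSwinnertonDyer.Theorems
  Summit.BirchSwinnertonDyer.BirchSwinnertonDyer.Theorems.Rank1ResidualX1Defs

namespace Summit.BirchSwinnertonDyer.BirchSwinnertonDyer.Theorems.EisensteinPrimesMazurMCOnX1RankZeroCongruenceRoadMuPartStub

open EisensteinPrimesMazurMCOnX1RankZeroCongruenceRoadMuPart

variable {W₀ V : WeierstrassCurve ℚ} [W₀.IsElliptic] [W₀.IsGloballyMinimal] [V.IsElliptic]
  [V.IsGloballyMinimal] {p : ℕ} [hp : Fact p.Prime]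


/-! ## §4 The registered stub decomposed along the road: stub ⟺ (S′) ∧ (M′) -/

/-- **`stub_analyticMuZero_offLocus` from a PARTNER SUPPLY (S′) and the μ-PART (M′).** (S′): every
rank-`0` X1 curve off the barrier locus has a GOOD-ORDINARY `E[p]`-congruent partner carrying the
certificate `μ_an = 0`; (M′): `MuPartAt W₀ p` at every such curve. Conclusion: verbatim the registered
signature of the stub of line `mudescent` on stmt-BirchSwinnertonDyer-19035. Compared with the
predecessor's `stub ⇐ (T) ∧ (S)`, the unprinted (T) is replaced by the μ-part of the main conjecture
at the target (§3). [cite: GreenbergVatsal2000, Thm. (1.4), p. 4 and p. 27] [cite: Wuthrich2014, Thm. 16 (p. 397)] -/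
theorem stub_of_partnerSupply_of_muPart (hW16 : Wuthrich2014.charIdeal_dvd_padicLFunction)
    (hmod : nonempty_modularParametrizationData) (hGV : imKummer_ge_greenbergCondition_at_p)
    (hA : lambda_nonPrimitive_eq_add_sum_delta) (hB : divisible_nonPrimitiveSelmerInfty_of_mu_eq_zero)
    (hS : ∀ (W₀ : WeierstrassCurve ℚ) [W₀.IsElliptic] [W₀.IsGloballyMinimal] (p : ℕ) [Fact p.Prime],
      ClassX1 W₀ p → W₀.analyticRank = 0 → ¬ HasRamifiedOddLineAt W₀ p →
      ∃ (V : WeierstrassCurve ℚ) (_ : V.IsElliptic) (_ : V.IsGloballyMinimal),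
        V.HasGoodReductionAtPrime p ∧ ¬ (p : ℤ) ∣ V.frobeniusTrace p ∧ TorsionIso W₀ V p ∧
        AnalyticMuLE V p 0)
    (hM : ∀ (W₀ : WeierstrassCurve ℚ) [W₀.IsElliptic] [W₀.IsGloballyMinimal] (p : ℕ) [Fact p.Prime],
      ClassX1 W₀ p → W₀.analyticRank = 0 → ¬ HasRamifiedOddLineAt W₀ p → MuPartAt W₀ p) :
    ∀ (W₀ : WeierstrassCurve ℚ) [W₀.IsElliptic] [W₀.IsGloballyMinimal] (p : ℕ) [Fact p.Prime],
      ClassX1 W₀ p → W₀.analyticRank = 0 → ¬ HasRamifiedOddLineAt W₀ p → AnalyticMuLE W₀ p 0 := by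
  intro W₀ _ _ p _ hX1 hr0 hoff
  have hX := isClassX1_of_classX1 hX1
  obtain ⟨V, _, _, hgoodV, hordV, hiso, hV⟩ := hS W₀ p hX1 hr0 hoff
  -- enter the binders of `AnalyticMuLE` (its `NeZero` instance binder is consumed eagerly otherwise)
  intro _ f hf ϖ hϖ
  exact (analyticMuLE_zero_iff_muPartAt_of_torsionIso_goodOrd hW16 hmod hGV hA hB hX.two_ne
    hX.hasGoodReductionAtPrime hX.not_dvd_frobeniusTrace hX.not_hasIrreducibleModPGaloisRep hgoodV
    hordV hiso hV).mpr (hM W₀ p hX1 hr0 hoff) f hf ϖ hϖ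

/-- **The stub supplies its own partner**: `stub_analyticMuZero_offLocus` ⇒ (S′), with `V := W₀` and the
identity `E[p] ≅ E[p]` — so (S′) is a WEAKENING of the stub, not an independent input. [folklore] -/
theorem partnerSupply_of_stub
    (hstub : ∀ (W₀ : WeierstrassCurve ℚ) [W₀.IsElliptic] [W₀.IsGloballyMinimal] (p : ℕ) [Fact p.Prime],
      ClassX1 W₀ p → W₀.analyticRank = 0 → ¬ HasRamifiedOddLineAt W₀ p → AnalyticMuLE W₀ p 0) :
    ∀ (W₀ : WeierstrassCurve ℚ) [W₀.IsElliptic] [W₀.IsGloballyMinimal] (p : ℕ) [Fact p.Prime],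
      ClassX1 W₀ p → W₀.analyticRank = 0 → ¬ HasRamifiedOddLineAt W₀ p →
      ∃ (V : WeierstrassCurve ℚ) (_ : V.IsElliptic) (_ : V.IsGloballyMinimal),
        V.HasGoodReductionAtPrime p ∧ ¬ (p : ℤ) ∣ V.frobeniusTrace p ∧ TorsionIso W₀ V p ∧
        AnalyticMuLE V p 0 := by
  intro W₀ _ _ p _ hX1 hr0 hoff
  have hX := isClassX1_of_classX1 hX1
  exact ⟨W₀, ‹_›, ‹_›, hX.hasGoodReductionAtPrime, hX.not_dvd_frobeniusTrace, torsionIso_refl W₀ p,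
    hstub W₀ p hX1 hr0 hoff⟩

/-- **THE STUB DECOMPOSED ALONG THE CONGRUENCE ROAD: `stub ⟺ (S′) ∧ (M′)`**, granted Wuthrich Thm. 16,
modularity and GV p. 26 / (7) / Prop. (2.5). Compare the mu-b decomposition `stub ⟺ (M′) ∧ (G′)`
(p462224, (G′) = Greenberg's `μ = 0` at every étale end): the road relaxes (G′) to (S′) «SOME
`E[p]`-congruent good-ordinary curve has a unit coefficient in its Néron-normalised `p`-adic
`L`-function» (§2: (S′) ⇒ (G′)), and leaves the μ-part (M′) untouched. Neither conjunct is in print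
on a type-A class. [cite: GreenbergVatsal2000, Thm. (1.4), p. 4 and p. 27] [cite: GreenbergLNM1716, Conj. 1.11]
[cite: Wuthrich2014, Thm. 16 (p. 397)] -/
theorem stub_iff_partnerSupply_and_muPart (hW16 : Wuthrich2014.charIdeal_dvd_padicLFunction)
    (hmod : nonempty_modularParametrizationData) (hGV : imKummer_ge_greenbergCondition_at_p)
    (hA : lambda_nonPrimitive_eq_add_sum_delta) (hB : divisible_nonPrimitiveSelmerInfty_of_mu_eq_zero) :
    (∀ (W₀ : WeierstrassCurve ℚ) [W₀.IsElliptic] [W₀.IsGloballyMinimal] (p : ℕ) [Fact p.Prime],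
        ClassX1 W₀ p → W₀.analyticRank = 0 → ¬ HasRamifiedOddLineAt W₀ p → AnalyticMuLE W₀ p 0) ↔
      (∀ (W₀ : WeierstrassCurve ℚ) [W₀.IsElliptic] [W₀.IsGloballyMinimal] (p : ℕ) [Fact p.Prime],
          ClassX1 W₀ p → W₀.analyticRank = 0 → ¬ HasRamifiedOddLineAt W₀ p →
          ∃ (V : WeierstrassCurve ℚ) (_ : V.IsElliptic) (_ : V.IsGloballyMinimal),
            V.HasGoodReductionAtPrime p ∧ ¬ (p : ℤ) ∣ V.frobeniusTrace p ∧ TorsionIso W₀ V p ∧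
            AnalyticMuLE V p 0) ∧
        ∀ (W₀ : WeierstrassCurve ℚ) [W₀.IsElliptic] [W₀.IsGloballyMinimal] (p : ℕ) [Fact p.Prime],
          ClassX1 W₀ p → W₀.analyticRank = 0 → ¬ HasRamifiedOddLineAt W₀ p → MuPartAt W₀ p := by
  refine ⟨fun h ↦ ⟨partnerSupply_of_stub h, fun W₀ _ _ p _ hX1 hr0 hoff ↦ ?_⟩,
    fun h ↦ stub_of_partnerSupply_of_muPart hW16 hmod hGV hA hB h.1 h.2⟩
  have hX := isClassX1_of_classX1 hX1
  exact muPartAt_of_analyticMuLE_zero hW16 hX.two_ne hX.hasGoodReductionAtPrime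
    hX.not_dvd_frobeniusTrace hX.not_hasIrreducibleModPGaloisRep (h W₀ p hX1 hr0 hoff)

/-- **Multiplicative partners allowed** (the mixed direction; a multiplicative `E[p]`-partner of a
`ClassX1` curve is a split X2b curve, row A10): `stub ⇐ (S″) ∧ (M′)` with (S″) = every off-locus
rank-`0` X1 curve has an `E[p]`-congruent partner which is EITHER good ordinary with
`X1.MuPart.AnalyticMuLE V p 0` OR multiplicative with `X2.AnalyticMuLE V p 0`. Extra inputs by name for
the multiplicative case: `hWu`, `hT`, `hT'`, `hAm`, `hBm`, `hF`.
[cite: GreenbergVatsal2000, Thm. (1.4), p. 4 and p. 27] [cite: Wuthrich2014, Thm. 16 (p. 397)] -/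
theorem stub_of_partnerSupply'_of_muPart (hW16 : Wuthrich2014.charIdeal_dvd_padicLFunction)
    (hWu : Wuthrich2014.thm16_charIdeal_dvd_multiplicative_of_reducible)
    (hmod : nonempty_modularParametrizationData)
    (hT : Silverman1994_thmV53_corV54_tateUniformisation.{0})
    (hT' : Silverman1994_thmV53_tateUniformisation.{0})
    (hAm : lambda_nonPrimitive_eq_add_sum_delta_multiplicative)
    (hBm : datumSelmer_divisible_of_finite_torsionBy) (hF : datumStrictSelmer_lt_datumSelmer_of_split)
    (hGV : imKummer_ge_greenbergCondition_at_p) (hA : lambda_nonPrimitive_eq_add_sum_delta)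
    (hB : divisible_nonPrimitiveSelmerInfty_of_mu_eq_zero)
    (hS : ∀ (W₀ : WeierstrassCurve ℚ) [W₀.IsElliptic] [W₀.IsGloballyMinimal] (p : ℕ) [Fact p.Prime],
      ClassX1 W₀ p → W₀.analyticRank = 0 → ¬ HasRamifiedOddLineAt W₀ p →
      ∃ (V : WeierstrassCurve ℚ) (_ : V.IsElliptic) (_ : V.IsGloballyMinimal), TorsionIso W₀ V p ∧
        ((V.HasGoodReductionAtPrime p ∧ ¬ (p : ℤ) ∣ V.frobeniusTrace p ∧ AnalyticMuLE V p 0) ∨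
          (V.HasMultiplicativeReductionAtPrime p ∧ X2.AnalyticMuLE V p 0)))
    (hM : ∀ (W₀ : WeierstrassCurve ℚ) [W₀.IsElliptic] [W₀.IsGloballyMinimal] (p : ℕ) [Fact p.Prime],
      ClassX1 W₀ p → W₀.analyticRank = 0 → ¬ HasRamifiedOddLineAt W₀ p → MuPartAt W₀ p) :
    ∀ (W₀ : WeierstrassCurve ℚ) [W₀.IsElliptic] [W₀.IsGloballyMinimal] (p : ℕ) [Fact p.Prime],
      ClassX1 W₀ p → W₀.analyticRank = 0 → ¬ HasRamifiedOddLineAt W₀ p → AnalyticMuLE W₀ p 0 := by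
  intro W₀ _ _ p _ hX1 hr0 hoff
  have hX := isClassX1_of_classX1 hX1
  obtain ⟨V, _, _, hiso, hV⟩ := hS W₀ p hX1 hr0 hoff
  intro _ f hf ϖ hϖ
  rcases hV with ⟨hgoodV, hordV, hV⟩ | ⟨hmultV, hV⟩
  · exact (analyticMuLE_zero_iff_muPartAt_of_torsionIso_goodOrd hW16 hmod hGV hA hB hX.two_ne
      hX.hasGoodReductionAtPrime hX.not_dvd_frobeniusTrace hX.not_hasIrreducibleModPGaloisRep hgoodV
      hordV hiso hV).mpr (hM W₀ p hX1 hr0 hoff) f hf ϖ hϖ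
  · exact (analyticMuLE_zero_iff_muPartAt_of_torsionIso_mult hW16 hWu hmod hT hT' hAm hBm hF hGV hA
      hX.two_ne hX.hasGoodReductionAtPrime hX.not_dvd_frobeniusTrace hX.not_hasIrreducibleModPGaloisRep
      hmultV hiso hV).mpr (hM W₀ p hX1 hr0 hoff) f hf ϖ hϖ

/-! ## §5 Circularity: (M′) — hence (T) at every leaf target — follows from the crux itself -/

/-- **The μ-part at the étale ends follows from the crux.** If Mazur's main conjecture holds at every
rank-`0` X1 pair (verbatim the conclusion predicate `Rank1ResidualX1Defs.MazurMainConjecture` of the crux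
`MazurMCOnX1RankZero`, stated here without importing the route file), then (M′) — indeed `MuPartAt` at
EVERY rank-`0` X1 member, located or not (`X1.MuLambda.mazurMainConjecture_iff_muPart_and_lambdaPart`).
[cite: GreenbergVatsal2000, (1)–(2) and p. 4] [cite: Wuthrich2014, Thm. 16 (p. 397)] -/
theorem muPart_offLocus_of_mazurMainConjecture (hW16 : Wuthrich2014.charIdeal_dvd_padicLFunction)
    (hMC : ∀ (W : WeierstrassCurve ℚ) [W.IsElliptic] [W.IsGloballyMinimal] (p : ℕ) [Fact p.Prime],
      ClassX1 W p → W.analyticRank = 0 → MazurMainConjecture W p) :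
    ∀ (W₀ : WeierstrassCurve ℚ) [W₀.IsElliptic] [W₀.IsGloballyMinimal] (p : ℕ) [Fact p.Prime],
      ClassX1 W₀ p → W₀.analyticRank = 0 → ¬ HasRamifiedOddLineAt W₀ p → MuPartAt W₀ p := by
  intro W₀ _ _ p _ hX1 hr0 _
  have hX := isClassX1_of_classX1 hX1
  exact ((mazurMainConjecture_iff_muPart_and_lambdaPart hW16 hX.two_ne hX.hasGoodReductionAtPrime
    hX.not_dvd_frobeniusTrace hX.not_hasIrreducibleModPGaloisRep).mp (hMC W₀ p hX1 hr0)).1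

/-- **Under the crux, the road's transfer (T) holds at every leaf target**: if Mazur's main conjecture
holds at every rank-`0` X1 pair, then for every rank-`0` X1 curve `W₀` (on or off the locus) and every
good-ordinary `V` with `W₀[p] ≅ V[p]`: `μ_an(V) = 0 ⇒ μ_an(W₀) = 0`. So (T) is no stronger than the crux
and the road is CONSISTENT — and closes nothing: its one unprinted step is the crux's own μ-part.
(With mu-b's `not_analyticMuLE_zero_of_leaf_of_ramified_line`: under the crux a leaf member ON the
barrier locus has no congruent good-ordinary partner with `μ_an = 0`.)
[cite: GreenbergVatsal2000, Thm. (1.4), p. 4 and p. 27] [cite: Wuthrich2014, Thm. 16 (p. 397)] -/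
theorem transfer_of_mazurMainConjecture (hW16 : Wuthrich2014.charIdeal_dvd_padicLFunction)
    (hmod : nonempty_modularParametrizationData) (hGV : imKummer_ge_greenbergCondition_at_p)
    (hA : lambda_nonPrimitive_eq_add_sum_delta) (hB : divisible_nonPrimitiveSelmerInfty_of_mu_eq_zero)
    (hMC : ∀ (W : WeierstrassCurve ℚ) [W.IsElliptic] [W.IsGloballyMinimal] (p : ℕ) [Fact p.Prime],
      ClassX1 W p → W.analyticRank = 0 → MazurMainConjecture W p)
    (hX1 : ClassX1 W₀ p) (hr0 : W₀.analyticRank = 0)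
    (hgoodV : V.HasGoodReductionAtPrime p) (hordV : ¬ (p : ℤ) ∣ V.frobeniusTrace p)
    (hiso : TorsionIso W₀ V p) (hV : AnalyticMuLE V p 0) : AnalyticMuLE W₀ p 0 := by
  have hX := isClassX1_of_classX1 hX1
  have hM : MuPartAt W₀ p :=
    ((mazurMainConjecture_iff_muPart_and_lambdaPart hW16 hX.two_ne hX.hasGoodReductionAtPrime
      hX.not_dvd_frobeniusTrace hX.not_hasIrreducibleModPGaloisRep).mp (hMC W₀ p hX1 hr0)).1
  intro _ f hf ϖ hϖ
  exact (analyticMuLE_zero_iff_muPartAt_of_torsionIso_goodOrd hW16 hmod hGV hA hB hX.two_ne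
    hX.hasGoodReductionAtPrime hX.not_dvd_frobeniusTrace hX.not_hasIrreducibleModPGaloisRep hgoodV
    hordV hiso hV).mpr hM f hf ϖ hϖ

end Summit.BirchSwinnertonDyer.BirchSwinnertonDyer.Theorems.EisensteinPrimesMazurMCOnX1RankZeroCongruenceRoadMuPartStub

end
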